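import Summits.QuantumAdvantage.AdviceFreeQNC0.CertificateTransfer
import Summits.QuantumAdvantage.AdviceFreeQNC0.FailFamilyDual
import HarnessLib

/-!
# Cell qa-qnc0 (rung F-Q1, fence F9-V): averaging over a row certificate and the CLOSE tail
# (Sketch10 `L7`, `L5`; part 1 of `ViolaFence.lean`, ask P-10V)

For the kernel form of FENCE F9-V (`violaFence_of_violaXor`, `ViolaFence.lean`):

* `massNotClose` / `massNotFar` — the `μ`-mass of rows not `δ`-close to / not `ε`-far from `𝓕_M(D)`
  (rows encoded as points of the `2^M`-cube, `FailFamilyDual.lean`);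
* **`averaging`** — if `RowCert M D s δ ε η` holds, some member `Φ` of the family has
  `polyBias μc Φ − polyBias μf Φ ≥ 2(1 − 2η − γc − γf)` for any distributions `μc`, `μf` with
  `massNotClose ≤ γc`, `massNotFar ≤ γf` (sum the two certificate guarantees over the rows, average over
  the family);
* **`massNotClose_le`** — under `unifOn 𝓕 ⊕ Ber(q)` the mass of rows at distance `> δ2^M` from `𝓕` is
  `≤ (1+q)^N / 2^{⌊δ2^M⌋+1}` (the distance is at most the noise weight; Markov on `2^{|noise|}`,
  `CubeDistr.ber_tail_le`), and `close_eventually`: for `q ≤ δ/2` this is `≤ e^{−0.19·δ·2^M} ≤ γ` for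
  large `M`.

[folklore] bookkeeping.  WHAT THIS IS NOT: nothing on α; separation NOT moved.
-/

noncomputable section

namespace Summit.QuantumAdvantage.AdviceFreeQNC0

namespace CubeDistr

open Finset
open Literature.Computability.Complexity.SmallBiasXor
open Literature.Computability.MetaComplexity Literature.Computability.MetaComplexity.Smolensky

variable {M : ℕ}

/-! ### Masses of non-close / non-far rows -/

/-- `μ`-mass of the rows that are NOT `δ`-close to `𝓕_M(D)`. -/
def massNotClose (M D : ℕ) (δ : ℝ) (μ : Distr (RN M)) : ℝ :=
  ∑ W : Fin (RN M) → Bool, if δ * (2 : ℝ) ^ M < (distFail D (toRow W) : ℝ) then μ W else 0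

/-- `μ`-mass of the rows that are NOT `ε`-far from `𝓕_M(D)`. -/
def massNotFar (M D : ℕ) (ε : ℝ) (μ : Distr (RN M)) : ℝ :=
  ∑ W : Fin (RN M) → Bool, if (distFail D (toRow W) : ℝ) < ε * (2 : ℝ) ^ M then μ W else 0

/-- `(N : ℝ) = 2^M`. -/
theorem RN_real (M : ℕ) : ((RN M : ℕ) : ℝ) = (2 : ℝ) ^ M := by
  rw [RN_eq]; push_cast; rfl

/-! ### Averaging over a certificate family (Sketch10 `L7`) -/

/-- **Averaging**: if a row certificate exists, some member separates a mostly-close distribution from a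
mostly-far one in `(−1)^Φ`-expectation. -/
theorem averaging {D s : ℕ} {δ ε η γc γf : ℝ} {μc μf : Distr (RN M)} (hμc : IsDistr μc) (hμf : IsDistr μf)
    (hη : 0 ≤ η) (hcert : RowCert M D s δ ε η) (hc : massNotClose M D δ μc ≤ γc)
    (hf : massNotFar M D ε μf ≤ γf) :
    ∃ Φ : ((Fin M → Bool) → Bool) → Bool, RowDeg M Φ s ∧
      2 * (1 - 2 * η - γc - γf) ≤
        polyBias μc (fun W => Φ (toRow W)) - polyBias μf (fun W => Φ (toRow W)) := by
  classical
  obtain ⟨k, hk, Φ, hdeg, hclose, hfar⟩ := hcert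
  have hkpos : (0 : ℝ) < k := by exact_mod_cast hk
  -- the firing mass under `μc` and the silent mass under `μf` of each member
  set Fc : Fin k → ℝ := fun i => ∑ W : Fin (RN M) → Bool, if Φ i (toRow W) = true then μc W else 0 with hFc
  set Sf : Fin k → ℝ := fun i => ∑ W : Fin (RN M) → Bool, if Φ i (toRow W) = false then μf W else 0 with hSf
  have hcardk : ∀ (P : Fin k → Prop) [DecidablePred P], ((univ.filter P).card : ℝ) ≤ k := by
    intro P _
    have h : (univ.filter P).card ≤ k := le_trans (Finset.card_le_univ _) (by rw [Fintype.card_fin])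
    exact_mod_cast h
  have hFc_le : ∑ i, Fc i ≤ k * (η + γc) := by
    have hswap : ∑ i, Fc i =
        ∑ W : Fin (RN M) → Bool, μc W * ((univ.filter fun i : Fin k => Φ i (toRow W) = true).card : ℝ) := by
      simp only [hFc]
      rw [Finset.sum_comm]
      refine Finset.sum_congr rfl fun W _ => ?_
      rw [Finset.natCast_card_filter, Finset.mul_sum]
      exact Finset.sum_congr rfl fun i _ => by split_ifs <;> simp
    rw [hswap]
    have hpt : ∀ W : Fin (RN M) → Bool,
        μc W * ((univ.filter fun i : Fin k => Φ i (toRow W) = true).card : ℝ) ≤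
          μc W * (η * k) + k * (if δ * (2 : ℝ) ^ M < (distFail D (toRow W) : ℝ) then μc W else 0) := by
      intro W
      have hW0 : 0 ≤ μc W := hμc.1 W
      by_cases hcl : (distFail D (toRow W) : ℝ) ≤ δ * (2 : ℝ) ^ M
      · have h1 := hclose (toRow W) hcl
        rw [if_neg (not_lt.2 hcl), mul_zero, add_zero]
        exact mul_le_mul_of_nonneg_left h1 hW0
      · rw [if_pos (not_le.1 hcl)]
        have h1 := hcardk (fun i : Fin k => Φ i (toRow W) = true)
        nlinarith [mul_le_mul_of_nonneg_left h1 hW0, mul_nonneg hW0 (mul_nonneg hη hkpos.le)]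
    calc ∑ W : Fin (RN M) → Bool, μc W * ((univ.filter fun i : Fin k => Φ i (toRow W) = true).card : ℝ)
        ≤ ∑ W : Fin (RN M) → Bool, (μc W * (η * k) +
            k * (if δ * (2 : ℝ) ^ M < (distFail D (toRow W) : ℝ) then μc W else 0)) :=
          Finset.sum_le_sum fun W _ => hpt W
      _ = (∑ W, μc W) * (η * k) + k * massNotClose M D δ μc := by
          rw [Finset.sum_add_distrib, ← Finset.sum_mul, ← Finset.mul_sum]; rfl
      _ ≤ k * (η + γc) := by rw [hμc.2]; nlinarith [mul_le_mul_of_nonneg_left hc hkpos.le]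
  have hSf_le : ∑ i, Sf i ≤ k * (η + γf) := by
    have hswap : ∑ i, Sf i =
        ∑ W : Fin (RN M) → Bool, μf W * ((univ.filter fun i : Fin k => Φ i (toRow W) = false).card : ℝ) := by
      simp only [hSf]
      rw [Finset.sum_comm]
      refine Finset.sum_congr rfl fun W _ => ?_
      rw [Finset.natCast_card_filter, Finset.mul_sum]
      exact Finset.sum_congr rfl fun i _ => by split_ifs <;> simp
    rw [hswap]
    have hpt : ∀ W : Fin (RN M) → Bool,
        μf W * ((univ.filter fun i : Fin k => Φ i (toRow W) = false).card : ℝ) ≤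
          μf W * (η * k) + k * (if (distFail D (toRow W) : ℝ) < ε * (2 : ℝ) ^ M then μf W else 0) := by
      intro W
      have hW0 : 0 ≤ μf W := hμf.1 W
      by_cases hfa : ε * (2 : ℝ) ^ M ≤ (distFail D (toRow W) : ℝ)
      · have h1 := hfar (toRow W) hfa
        rw [if_neg (not_lt.2 hfa), mul_zero, add_zero]
        exact mul_le_mul_of_nonneg_left h1 hW0
      · rw [if_pos (not_le.1 hfa)]
        have h1 := hcardk (fun i : Fin k => Φ i (toRow W) = false)
        nlinarith [mul_le_mul_of_nonneg_left h1 hW0, mul_nonneg hW0 (mul_nonneg hη hkpos.le)]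
    calc ∑ W : Fin (RN M) → Bool, μf W * ((univ.filter fun i : Fin k => Φ i (toRow W) = false).card : ℝ)
        ≤ ∑ W : Fin (RN M) → Bool, (μf W * (η * k) +
            k * (if (distFail D (toRow W) : ℝ) < ε * (2 : ℝ) ^ M then μf W else 0)) :=
          Finset.sum_le_sum fun W _ => hpt W
      _ = (∑ W, μf W) * (η * k) + k * massNotFar M D ε μf := by
          rw [Finset.sum_add_distrib, ← Finset.sum_mul, ← Finset.mul_sum]; rfl
      _ ≤ k * (η + γf) := by rw [hμf.2]; nlinarith [mul_le_mul_of_nonneg_left hf hkpos.le]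
  -- one member is good on both counts
  obtain ⟨i, -, hi⟩ : ∃ i ∈ (univ : Finset (Fin k)), Fc i + Sf i ≤ 2 * η + γc + γf := by
    apply Finset.exists_le_of_sum_le ⟨⟨0, hk⟩, Finset.mem_univ _⟩
    rw [Finset.sum_add_distrib, Finset.sum_const, Finset.card_univ, Fintype.card_fin, nsmul_eq_mul]
    linarith
  refine ⟨Φ i, hdeg i, ?_⟩
  rw [polyBias_eq μc hμc.2, polyBias_eq μf hμf.2]
  have hsplit : (∑ W : Fin (RN M) → Bool, if Φ i (toRow W) = true then μf W else 0) = 1 - Sf i := by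
    have h : (∑ W : Fin (RN M) → Bool, if Φ i (toRow W) = true then μf W else 0) + Sf i = ∑ W, μf W := by
      simp only [hSf]
      rw [← Finset.sum_add_distrib]
      exact Finset.sum_congr rfl fun W _ => by cases Φ i (toRow W) <;> simp
    linarith [hμf.2]
  have hFci : (∑ W : Fin (RN M) → Bool, if Φ i (toRow W) = true then μc W else 0) = Fc i := rfl
  rw [hsplit, hFci]
  linarith

/-! ### The close tail: noisy fail words are `δ`-close (Sketch10 `L5`, by exponential moments) -/

/-- Distance of a noisy coset word to the coset is at most the noise weight, through the encoding. -/
theorem hdist_toRow_bxor (V E : Fin (RN M) → Bool) : hdist (toRow (bxor V E)) (toRow V) = hw E := by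
  unfold hdist hw toRow bxor
  rw [← card_filter_enc (fun i : Fin (RN M) => E i = true)]
  congr 1
  ext v
  simp only [Finset.mem_filter, Finset.mem_univ, true_and, ne_eq]
  cases V (Fintype.equivFin (Fin M → Bool) v) <;> cases E (Fintype.equivFin (Fin M → Bool) v) <;> simp

/-- **Close tail**: under `unifOn 𝓕 ⊕ Ber(q)` the mass of rows at distance `> δ2^M` from `𝓕` is at most
`(1+q)^N / 2^{⌊δ2^M⌋+1}`. -/
theorem massNotClose_le {D : ℕ} {δ q : ℝ} (hδ0 : 0 ≤ δ) (hq0 : 0 ≤ q) (hq1 : q ≤ 1) :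
    massNotClose M D δ (xorConv (unifOn (failSetW M D)) (ber (RN M) q)) ≤
      (1 + q) ^ RN M / (2 : ℝ) ^ (⌊δ * (2 : ℝ) ^ M⌋₊ + 1) := by
  classical
  set S := failSetW M D with hS
  set k := ⌊δ * (2 : ℝ) ^ M⌋₊ + 1 with hk
  set bad : (Fin (RN M) → Bool) → Prop := fun W => δ * (2 : ℝ) ^ M < (distFail D (toRow W) : ℝ) with hbad
  unfold massNotClose
  simp only [xorConv_apply]
  -- exchange the sums
  have h1 : (∑ W : Fin (RN M) → Bool, if bad W then ∑ V, unifOn S V * ber (RN M) q (bxor V W) else 0) =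
      ∑ V, unifOn S V * ∑ W : Fin (RN M) → Bool, (if bad W then ber (RN M) q (bxor V W) else 0) := by
    have h : ∀ W : Fin (RN M) → Bool, (if bad W then ∑ V, unifOn S V * ber (RN M) q (bxor V W) else 0) =
        ∑ V, unifOn S V * (if bad W then ber (RN M) q (bxor V W) else 0) := by
      intro W; split_ifs <;> simp
    rw [Finset.sum_congr rfl fun W _ => h W, Finset.sum_comm]
    exact Finset.sum_congr rfl fun V _ => by rw [Finset.mul_sum]
  rw [h1]
  -- bound each inner sum by the Bernoulli tail
  have h2 : ∀ V, unifOn S V * (∑ W : Fin (RN M) → Bool, (if bad W then ber (RN M) q (bxor V W) else 0)) ≤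
      unifOn S V * ((1 + q) ^ RN M / (2 : ℝ) ^ k) := by
    intro V
    by_cases hV : V ∈ S
    · refine mul_le_mul_of_nonneg_left ?_ ((isDistr_unifOn ⟨V, hV⟩).1 V)
      rw [← sum_bxor V (fun W => if bad W then ber (RN M) q (bxor V W) else 0)]
      simp only [bxor_bxor_cancel]
      refine le_trans (Finset.sum_le_sum fun E _ => ?_) (ber_tail_le hq0 hq1 k)
      have hE0 : 0 ≤ ber (RN M) q E := (isDistr_ber hq0 hq1).1 E
      by_cases hb : bad (bxor V E)
      · have hkE : k ≤ hw E := by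
          have hle : distFail D (toRow (bxor V E)) ≤ hw E :=
            le_trans (distFail_le _ ((mem_failSetW (M := M)).1 hV)) (le_of_eq (hdist_toRow_bxor V E))
          have hlt : δ * (2 : ℝ) ^ M < (hw E : ℝ) := lt_of_lt_of_le hb (by exact_mod_cast hle)
          have := (Nat.floor_lt (by positivity)).2 hlt
          omega
        rw [if_pos hb, if_pos hkE]
      · rw [if_neg hb]; split_ifs <;> linarith
    · have h0 : unifOn S V = 0 := if_neg hV
      rw [h0, zero_mul, zero_mul]
  calc ∑ V, unifOn S V * ∑ W : Fin (RN M) → Bool, (if bad W then ber (RN M) q (bxor V W) else 0)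
      ≤ ∑ V, unifOn S V * ((1 + q) ^ RN M / (2 : ℝ) ^ k) := Finset.sum_le_sum fun V _ => h2 V
    _ = (1 + q) ^ RN M / (2 : ℝ) ^ k := by
        rw [← Finset.sum_mul, (isDistr_unifOn (failSetW_nonempty M D)).2, one_mul]

/-- The close tail is eventually small: for `q ≤ δ/2`, `(1+q)^N/2^{⌊δN⌋+1} ≤ e^{−0.19·δN} ≤ γ`. -/
theorem close_eventually {δ γ : ℝ} (hδ0 : 0 < δ) (hγ : 0 < γ) :
    ∃ M₀ : ℕ, ∀ M : ℕ, M₀ ≤ M → ∀ q : ℝ, 0 ≤ q → q ≤ δ / 2 →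
      (1 + q) ^ RN M / (2 : ℝ) ^ (⌊δ * (2 : ℝ) ^ M⌋₊ + 1) ≤ γ := by
  refine ⟨⌈(- Real.log γ) / (0.19 * δ)⌉₊, fun M hM q hq0 hqδ => ?_⟩
  have hlog2 := Real.log_two_gt_d9
  have hlog2pos : 0 < Real.log 2 := Real.log_pos one_lt_two
  have hN : ((RN M : ℕ) : ℝ) = (2 : ℝ) ^ M := RN_real M
  have hMN : (M : ℝ) ≤ (2 : ℝ) ^ M := by exact_mod_cast (Nat.lt_two_pow_self).le
  have hM' : (- Real.log γ) / (0.19 * δ) ≤ M := le_trans (Nat.le_ceil _) (by exact_mod_cast hM)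
  -- numerator ≤ exp(q N)
  have hnum : (1 + q) ^ RN M ≤ Real.exp (q * (2 : ℝ) ^ M) := by
    have h1 : 1 + q ≤ Real.exp q := by linarith [Real.add_one_le_exp q]
    calc (1 + q) ^ RN M ≤ (Real.exp q) ^ RN M := pow_le_pow_left₀ (by linarith) h1 _
      _ = Real.exp (q * (2 : ℝ) ^ M) := by rw [← Real.exp_nat_mul, hN, mul_comm]
  -- denominator ≥ exp(δ N log 2)
  have hden : Real.exp (δ * (2 : ℝ) ^ M * Real.log 2) ≤ (2 : ℝ) ^ (⌊δ * (2 : ℝ) ^ M⌋₊ + 1) := by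
    have hk : δ * (2 : ℝ) ^ M ≤ ((⌊δ * (2 : ℝ) ^ M⌋₊ + 1 : ℕ) : ℝ) := by
      push_cast; exact (Nat.lt_floor_add_one _).le
    have h2 : (2 : ℝ) ^ (⌊δ * (2 : ℝ) ^ M⌋₊ + 1) =
        Real.exp (((⌊δ * (2 : ℝ) ^ M⌋₊ + 1 : ℕ) : ℝ) * Real.log 2) := by
      rw [Real.exp_nat_mul, Real.exp_log two_pos]
    rw [h2]
    exact Real.exp_le_exp.2 (mul_le_mul_of_nonneg_right hk hlog2pos.le)
  have hden_pos : (0 : ℝ) < (2 : ℝ) ^ (⌊δ * (2 : ℝ) ^ M⌋₊ + 1) := by positivity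
  calc (1 + q) ^ RN M / (2 : ℝ) ^ (⌊δ * (2 : ℝ) ^ M⌋₊ + 1)
      ≤ Real.exp (q * (2 : ℝ) ^ M) / Real.exp (δ * (2 : ℝ) ^ M * Real.log 2) := by
        gcongr
    _ = Real.exp (q * (2 : ℝ) ^ M - δ * (2 : ℝ) ^ M * Real.log 2) := by rw [Real.exp_sub]
    _ ≤ Real.exp (-(0.19 * δ * M)) := by
        apply Real.exp_le_exp.2
        have h2M : (0 : ℝ) ≤ (2 : ℝ) ^ M := by positivity
        nlinarith [mul_le_mul_of_nonneg_right hqδ h2M, mul_le_mul_of_nonneg_left hMN hδ0.le,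
          mul_nonneg hδ0.le h2M]
    _ ≤ Real.exp (Real.log γ) := by
        apply Real.exp_le_exp.2
        have h019 : (0 : ℝ) < 0.19 * δ := by positivity
        have := (div_le_iff₀ h019).1 hM'
        linarith
    _ = γ := Real.exp_log hγ

end CubeDistr

end Summit.QuantumAdvantage.AdviceFreeQNC0
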